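import Literature.Probability.Process.BrownianSmallBall
import Mathlib.Analysis.Complex.ExponentialBounds
import HarnessLib

/-!
# Tubes of Wiener measure around Lipschitz paths have positive probability

Trunk T-PROBABILITY (Literature/Probability/Process). For the canonical Brownian motion `B` under
the pre-Wiener measure and a path `f : ℝ≥0 → ℝ` with `f 0 = 0` which is Lipschitz on `[0, t]`,
every sup-norm tube around `f` has positive probability:

* `measure_forall_abs_brownian_sub_le_pos` — `P(∀ s ≤ t, |B_s − f s| ≤ ε) > 0` for all `t ≥ 0`,
  `ε > 0`;
* `wienerPair_forall_abs_brownian_sub_le_pos` — the same for the pair of independent Brownian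
  motions (`wienerPair`, `BrownianPair.lean`) and two Lipschitz paths.

This is the lower-bound half of the support theorem for Wiener measure (the topological support of
the law of `(B_s)_{s ≤ t}` in `C[0, t]` is `{f : f(0) = 0}`; Freedman, *Brownian Motion and
Diffusion* (1971), §1.6; Stroock–Varadhan (1972), §3), for Lipschitz centres — which is what the
applications use (reaching a neighbourhood of a prescribed piecewise-linear driving function with
positive probability); continuous centres follow by uniform approximation. It extends the tree's
zero-centre case `measure_forall_abs_brownian_le_pos` (`BrownianSmallBall.lean`), by the same
elementary block method (weak Markov property and second/fourth moments only; no Cameron–Martin):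

with `α = ε/5` and a block length `τ = t/n ∈ [α²/4, α²/2]` (after shrinking `ε` so that
`L ε ≤ 1`, `L` the Lipschitz constant, whence `f` moves by at most `Lτ ≤ α/8` on a block), call
block `k` *good* if the increments `B_{kτ+u} − B_{kτ}`, `u ≤ τ`, stay in `[−3α, 3α]` and the total
increment lies in `[−7α/8, −α/8]` when `B_{kτ} ≥ f(kτ)`, in `[α/8, 7α/8]` otherwise. If the first
`k` blocks are good then `|B_{kτ} − f(kτ)| ≤ α` and `|B_s − f s| ≤ α + 3α + α/8 ≤ ε` on `[0, kτ]`
(induction). By the Markov factorisation of `BrownianSmallBall`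
(`measure_inter_shift_preimage_ge`), `P(first k+1 good) ≥ p₀ · P(first k good)` with
`p₀ = min_± P(sup_{u≤τ}|B_u| ≤ 3α, ±B_τ ∈ [−7α/8, −α/8]) ≥ 1/24 − 2/289 > 0`
(the Gaussian density on `[−7α/8, −α/8]` is at least `1/(18α)` for `τ ∈ [α²/4, α²/2]`, using only
`π ≤ 4` and `e < 3`; the running maximum is controlled by `measure_exists_le_abs_brownian_le` of
`BrownianSupTail.lean`). Hence `P ≥ p₀ⁿ > 0`. (Very short horizons `t < α²/2` reduce to the
zero-centre small ball of radius `ε/2`.)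

## References

* D. Freedman, *Brownian Motion and Diffusion* (Holden-Day, 1971), §1.6 (Lemma (38) and the
  support of Wiener measure).
* D. W. Stroock, S. R. S. Varadhan, *On the support of diffusion processes with applications to
  the strong maximum principle*, Proc. Sixth Berkeley Symp. III (1972) 333–359, §3. [folklore]
-/

noncomputable section

open MeasureTheory ProbabilityTheory Filter Topology Set
open scoped NNReal ENNReal

namespace Literature.Probability.Process

/-! ### A Gaussian lower bound: the density on `[−7α/8, 7α/8]` for variances in `[α²/4, α²/2]` -/

/-- **Pointwise lower bound for the centred Gaussian density**: for `α > 0`, `α²/4 ≤ v ≤ α²/2` and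
`|x| ≤ 7α/8`, `gaussianPDFReal 0 v x ≥ 1/(18α)` — since
`(2πv)^{-1/2} e^{-x²/(2v)} ≥ (α√π)⁻¹ e^{-49/32} ≥ (2α)⁻¹ · 9⁻¹` (`π ≤ 4`, `e < 3`). [folklore] -/
theorem one_div_le_gaussianPDFReal_of_abs_le {α : ℝ} (hα : 0 < α) {v : ℝ≥0} (hv1 : α ^ 2 / 4 ≤ (v : ℝ))
    (hv2 : (v : ℝ) ≤ α ^ 2 / 2) {x : ℝ} (hx : |x| ≤ 7 * α / 8) :
    1 / (18 * α) ≤ gaussianPDFReal 0 v x := by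
  have hvpos : 0 < (v : ℝ) := lt_of_lt_of_le (by positivity) hv1
  rw [gaussianPDFReal]
  -- the prefactor: `(√(2πv))⁻¹ ≥ (2α)⁻¹`
  have hsqrt : Real.sqrt (2 * Real.pi * v) ≤ 2 * α := by
    rw [Real.sqrt_le_left (by positivity)]
    calc 2 * Real.pi * v ≤ 2 * 4 * (α ^ 2 / 2) := by
          gcongr
          exact Real.pi_le_four
      _ = (2 * α) ^ 2 := by ring
  have hpre : (2 * α)⁻¹ ≤ (Real.sqrt (2 * Real.pi * v))⁻¹ := by
    rw [inv_le_inv₀ (by positivity) (Real.sqrt_pos.2 (by positivity))]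
    exact hsqrt
  -- the exponential: `exp(-x²/(2v)) ≥ exp(-2) ≥ 1/9`
  have hx2 : x ^ 2 ≤ (7 * α / 8) ^ 2 := by
    calc x ^ 2 = |x| ^ 2 := (sq_abs x).symm
      _ ≤ (7 * α / 8) ^ 2 := pow_le_pow_left₀ (abs_nonneg x) hx 2
  have hexp : Real.exp (-2) ≤ Real.exp (-(x - 0) ^ 2 / (2 * v)) := by
    rw [Real.exp_le_exp, sub_zero]
    rw [le_div_iff₀ (by positivity)]
    nlinarith
  have he2 : (1 : ℝ) / 9 ≤ Real.exp (-2) := by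
    have h3 := Real.exp_one_lt_three
    have hpos := Real.exp_pos (1 : ℝ)
    have : Real.exp (-2) = (Real.exp 1 * Real.exp 1)⁻¹ := by
      rw [← Real.exp_add, ← Real.exp_neg]
      norm_num
    rw [this, one_div, inv_le_inv₀ (by positivity) (by norm_num)]
    nlinarith
  calc 1 / (18 * α) = (2 * α)⁻¹ * (1 / 9) := by field_simp; ring
    _ ≤ (Real.sqrt (2 * Real.pi * v))⁻¹ * Real.exp (-(x - 0) ^ 2 / (2 * v)) :=
        mul_le_mul hpre (he2.trans hexp) (by norm_num) (inv_nonneg.2 (Real.sqrt_nonneg _))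

/-- **`P(N(0, v) ∈ [−7α/8, −α/8]) ≥ 1/24`** for `α²/4 ≤ v ≤ α²/2` (length `3α/4` times the density
bound `1/(18α)`). [folklore] -/
theorem gaussianReal_Icc_neg_ge {α : ℝ} (hα : 0 < α) {v : ℝ≥0} (hv1 : α ^ 2 / 4 ≤ (v : ℝ))
    (hv2 : (v : ℝ) ≤ α ^ 2 / 2) :
    ENNReal.ofReal (1 / 24) ≤ gaussianReal 0 v (Icc (-(7 * α / 8)) (-(α / 8))) := by
  have hvpos : 0 < (v : ℝ) := lt_of_lt_of_le (by positivity) hv1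
  have hv0 : v ≠ 0 := fun h ↦ by rw [h, NNReal.coe_zero] at hvpos; exact lt_irrefl _ hvpos
  rw [gaussianReal_apply 0 hv0]
  have hbound : ∀ x ∈ Icc (-(7 * α / 8)) (-(α / 8)),
      ENNReal.ofReal (1 / (18 * α)) ≤ gaussianPDF 0 v x := by
    intro x hx
    rw [gaussianPDF]
    refine ENNReal.ofReal_le_ofReal (one_div_le_gaussianPDFReal_of_abs_le hα hv1 hv2 ?_)
    rw [abs_le]
    constructor <;> linarith [hx.1, hx.2]
  calc ENNReal.ofReal (1 / 24) = ENNReal.ofReal (1 / (18 * α)) * volume (Icc (-(7 * α / 8)) (-(α / 8))) := by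
        rw [Real.volume_Icc, ← ENNReal.ofReal_mul (by positivity)]
        congr 1
        field_simp
        ring
    _ = ∫⁻ _ in Icc (-(7 * α / 8)) (-(α / 8)), ENNReal.ofReal (1 / (18 * α)) := by
        rw [setLIntegral_const]
    _ ≤ ∫⁻ x in Icc (-(7 * α / 8)) (-(α / 8)), gaussianPDF 0 v x :=
        setLIntegral_mono (measurable_gaussianPDF 0 v) hbound

/-- The mirror image: **`P(N(0, v) ∈ [α/8, 7α/8]) ≥ 1/24`**. [folklore] -/
theorem gaussianReal_Icc_pos_ge {α : ℝ} (hα : 0 < α) {v : ℝ≥0} (hv1 : α ^ 2 / 4 ≤ (v : ℝ))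
    (hv2 : (v : ℝ) ≤ α ^ 2 / 2) :
    ENNReal.ofReal (1 / 24) ≤ gaussianReal 0 v (Icc (α / 8) (7 * α / 8)) := by
  have h := gaussianReal_map_neg (μ := 0) (v := v)
  rw [neg_zero] at h
  have : gaussianReal 0 v (Icc (α / 8) (7 * α / 8)) = gaussianReal 0 v (Icc (-(7 * α / 8)) (-(α / 8))) := by
    calc gaussianReal 0 v (Icc (α / 8) (7 * α / 8))
        = ((gaussianReal 0 v).map fun x => -x) (Icc (α / 8) (7 * α / 8)) := by rw [h]
      _ = gaussianReal 0 v ((fun x : ℝ => -x) ⁻¹' Icc (α / 8) (7 * α / 8)) :=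
          Measure.map_apply measurable_neg measurableSet_Icc
      _ = gaussianReal 0 v (Icc (-(7 * α / 8)) (-(α / 8))) := by
          congr 1
          ext x
          simp only [mem_preimage, mem_Icc]
          constructor
          · rintro ⟨h1, h2⟩; constructor <;> linarith
          · rintro ⟨h1, h2⟩; constructor <;> linarith
  rw [this]
  exact gaussianReal_Icc_neg_ge hα hv1 hv2

/-! ### The block event with a general endpoint window -/

/-- **The tube block event is measurable**: `|w| ≤ ρ` at the dyadic times `m/2ⁿ ≤ τ` and the
endpoint `w(τ)` in `[−7α/8, −α/8]` (`b = true`) resp. `[α/8, 7α/8]` (`b = false`). [folklore] -/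
theorem measurableSet_tubeBlockEvent (τ : ℝ≥0) (ρ α : ℝ) (b : Bool) :
    MeasurableSet {w : ℝ≥0 → ℝ | (∀ n m : ℕ, ((m : ℝ≥0) / 2 ^ n ≤ τ) → |w ((m : ℝ≥0) / 2 ^ n)| ≤ ρ) ∧
      (if b then w τ ∈ Icc (-(7 * α / 8)) (-(α / 8)) else w τ ∈ Icc (α / 8) (7 * α / 8))} := by
  have h1 : MeasurableSet {w : ℝ≥0 → ℝ | ∀ n m : ℕ, ((m : ℝ≥0) / 2 ^ n ≤ τ) →
      |w ((m : ℝ≥0) / 2 ^ n)| ≤ ρ} := by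
    have : {w : ℝ≥0 → ℝ | ∀ n m : ℕ, ((m : ℝ≥0) / 2 ^ n ≤ τ) → |w ((m : ℝ≥0) / 2 ^ n)| ≤ ρ} =
        ⋂ n : ℕ, ⋂ m : ℕ, {w | ((m : ℝ≥0) / 2 ^ n ≤ τ) → |w ((m : ℝ≥0) / 2 ^ n)| ≤ ρ} := by
      ext w; simp
    rw [this]
    refine MeasurableSet.iInter fun n => MeasurableSet.iInter fun m => ?_
    by_cases hmn : (m : ℝ≥0) / 2 ^ n ≤ τ
    · simp only [hmn, forall_const]
      exact measurableSet_le (measurable_pi_apply _).abs measurable_const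
    · simp [hmn]
  have h2 : MeasurableSet {w : ℝ≥0 → ℝ | if b then w τ ∈ Icc (-(7 * α / 8)) (-(α / 8))
      else w τ ∈ Icc (α / 8) (7 * α / 8)} := by
    cases b
    · simp only [Bool.false_eq_true, ↓reduceIte]
      exact measurableSet_Icc.preimage (measurable_pi_apply τ)
    · simp only [↓reduceIte]
      exact measurableSet_Icc.preimage (measurable_pi_apply τ)
  exact h1.inter h2

/-! ### Good blocks relative to the centre `f`

Below `E b` is the tube block event (in-block bound `ρ = 3α`) and `B k` the event "block `k` is
good": the shifted path `θ_{kτ} ω` lies in `E [B_{kτ} ≥ f(kτ)]`. -/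

section Blocks

variable {τ : ℝ≥0} {α : ℝ} {f : ℝ≥0 → ℝ} {E : Bool → Set (ℝ≥0 → ℝ)} {B : ℕ → Set (ℝ≥0 → ℝ)}
  (hE : ∀ b, E b = {w : ℝ≥0 → ℝ | (∀ n m : ℕ, ((m : ℝ≥0) / 2 ^ n ≤ τ) →
      |w ((m : ℝ≥0) / 2 ^ n)| ≤ 3 * α) ∧
        (if b then w τ ∈ Icc (-(7 * α / 8)) (-(α / 8)) else w τ ∈ Icc (α / 8) (7 * α / 8))})
  (hB : ∀ k : ℕ, B k = {ω | (fun u => brownian ((k : ℝ≥0) * τ + u) ω - brownian ((k : ℝ≥0) * τ) ω) ∈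
      E (decide (f ((k : ℝ≥0) * τ) ≤ brownian ((k : ℝ≥0) * τ) ω))})

include hE in
/-- The block events are measurable. [folklore] -/
private theorem measurableSet_of_eq_tubeBlockEvent (b : Bool) : MeasurableSet (E b) := by
  rw [hE]
  exact measurableSet_tubeBlockEvent τ (3 * α) α b

include hE hB in
/-- Unfolding "block `k` is good". [folklore] -/
private theorem mem_tubeBlockGood_iff (k : ℕ) (ω : ℝ≥0 → ℝ) :
    ω ∈ B k ↔
      (∀ n m : ℕ, ((m : ℝ≥0) / 2 ^ n ≤ τ) →
        |brownian ((k : ℝ≥0) * τ + (m : ℝ≥0) / 2 ^ n) ω - brownian ((k : ℝ≥0) * τ) ω| ≤ 3 * α) ∧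
      (if decide (f ((k : ℝ≥0) * τ) ≤ brownian ((k : ℝ≥0) * τ) ω) then
        brownian ((k : ℝ≥0) * τ + τ) ω - brownian ((k : ℝ≥0) * τ) ω ∈ Icc (-(7 * α / 8)) (-(α / 8))
       else brownian ((k : ℝ≥0) * τ + τ) ω - brownian ((k : ℝ≥0) * τ) ω ∈ Icc (α / 8) (7 * α / 8)) := by
  rw [hB, mem_setOf_eq, hE, mem_setOf_eq]

include hE hB in
/-- Measurability of "block `k` is good" with respect to any σ-algebra making the coordinates up
to time `(k+1)τ` measurable. [folklore] -/
private theorem measurableSet_tubeBlockGood' {m : MeasurableSpace (ℝ≥0 → ℝ)} (k : ℕ)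
    (hm : ∀ u : ℝ≥0, u ≤ (k : ℝ≥0) * τ + τ → Measurable[m] (brownian u)) :
    MeasurableSet[m] (B k) := by
  have hk : Measurable[m] (brownian ((k : ℝ≥0) * τ)) := hm _ le_self_add
  have hkτ : Measurable[m] (brownian ((k : ℝ≥0) * τ + τ)) := hm _ le_rfl
  have hset : B k =
      {ω : ℝ≥0 → ℝ | ∀ n j : ℕ, ((j : ℝ≥0) / 2 ^ n ≤ τ) →
        |brownian ((k : ℝ≥0) * τ + (j : ℝ≥0) / 2 ^ n) ω - brownian ((k : ℝ≥0) * τ) ω| ≤ 3 * α} ∩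
      (({ω | f ((k : ℝ≥0) * τ) ≤ brownian ((k : ℝ≥0) * τ) ω} ∩
          {ω | brownian ((k : ℝ≥0) * τ + τ) ω - brownian ((k : ℝ≥0) * τ) ω ∈
            Icc (-(7 * α / 8)) (-(α / 8))}) ∪
        ({ω | ¬ f ((k : ℝ≥0) * τ) ≤ brownian ((k : ℝ≥0) * τ) ω} ∩
          {ω | brownian ((k : ℝ≥0) * τ + τ) ω - brownian ((k : ℝ≥0) * τ) ω ∈
            Icc (α / 8) (7 * α / 8)})) := by
    ext ω
    rw [mem_tubeBlockGood_iff hE hB]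
    simp only [mem_setOf_eq, mem_union, mem_inter_iff]
    by_cases h0 : f ((k : ℝ≥0) * τ) ≤ brownian ((k : ℝ≥0) * τ) ω
    · simp [h0]
    · simp [h0]
  rw [hset]
  refine MeasurableSet.inter ?_ (MeasurableSet.union ((measurableSet_le measurable_const hk).inter ?_)
      ((measurableSet_le measurable_const hk).compl.inter ?_))
  · have : {ω : ℝ≥0 → ℝ | ∀ n j : ℕ, ((j : ℝ≥0) / 2 ^ n ≤ τ) →
        |brownian ((k : ℝ≥0) * τ + (j : ℝ≥0) / 2 ^ n) ω - brownian ((k : ℝ≥0) * τ) ω| ≤ 3 * α} =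
        ⋂ n : ℕ, ⋂ j : ℕ, {ω | ((j : ℝ≥0) / 2 ^ n ≤ τ) →
          |brownian ((k : ℝ≥0) * τ + (j : ℝ≥0) / 2 ^ n) ω - brownian ((k : ℝ≥0) * τ) ω| ≤ 3 * α} := by
      ext ω; simp
    rw [this]
    refine MeasurableSet.iInter fun n => MeasurableSet.iInter fun j => ?_
    by_cases hjn : (j : ℝ≥0) / 2 ^ n ≤ τ
    · simp only [hjn, forall_const]
      exact measurableSet_le ((hm _ (by gcongr)).sub hk).abs measurable_const
    · simp [hjn]
  · exact measurableSet_Icc.preimage (hkτ.sub hk)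
  · exact measurableSet_Icc.preimage (hkτ.sub hk)

include hE hB in
/-- "Block `k` is good" is measurable. [folklore] -/
private theorem measurableSet_tubeBlockGood (k : ℕ) : MeasurableSet (B k) :=
  measurableSet_tubeBlockGood' hE hB k fun u _ => measurable_brownian u

include hE hB in
/-- "The first `k` blocks are good" is measurable with respect to the past `σ(B_u : u ≤ kτ)`.
[folklore] -/
private theorem measurableSet_tubeGoodUpTo_comap (k : ℕ) :
    MeasurableSet[MeasurableSpace.comap (fun (ω : ℝ≥0 → ℝ) (v : Iic ((k : ℝ≥0) * τ)) => brownian v ω)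
      inferInstance] {ω | ∀ j < k, ω ∈ B j} := by
  refine measurableSet_setOf_forall_lt fun j hj => ?_
  refine measurableSet_tubeBlockGood' hE hB j fun u hu => measurable_brownian_comap_past (hu.trans ?_)
  calc (j : ℝ≥0) * τ + τ = ((j : ℝ≥0) + 1) * τ := by ring
    _ ≤ (k : ℝ≥0) * τ := by
        gcongr
        exact_mod_cast Nat.succ_le_of_lt hj

include hE hB in
/-- "The first `k` blocks are good" is measurable. [folklore] -/
private theorem measurableSet_tubeGoodUpTo (k : ℕ) : MeasurableSet {ω | ∀ j < k, ω ∈ B j} :=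
  measurableSet_setOf_forall_lt fun j _ => measurableSet_tubeBlockGood hE hB j

/-! ### Good blocks confine the path to the tube -/

include hE hB in
/-- **If the first `k` blocks are good then `|B_{kτ} − f(kτ)| ≤ α` and `|B_s − f s| ≤ 5α` for
`s ≤ kτ`**, provided `f` moves by at most `α/8` over each time span `≤ τ` inside `[0, kτ]`
(induction on `k`: the sign rule and the endpoint window `∓[α/8, 7α/8]` bring the anchor back to
`[−α, α]`; inside a block the path moves by at most `3α` and `f` by at most `α/8`). [folklore] -/
theorem abs_brownian_sub_le_of_mem_tubeGoodUpTo (hα : 0 ≤ α) (hf0 : f 0 = 0) {k : ℕ}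
    (hfmod : ∀ s u : ℝ≥0, s ≤ u → u ≤ (k : ℝ≥0) * τ → u ≤ s + τ → |f u - f s| ≤ α / 8)
    {ω : ℝ≥0 → ℝ} (hω : ω ∈ {ω | ∀ j < k, ω ∈ B j}) :
    |brownian ((k : ℝ≥0) * τ) ω - f ((k : ℝ≥0) * τ)| ≤ α ∧
      ∀ s : ℝ≥0, s ≤ (k : ℝ≥0) * τ → |brownian s ω - f s| ≤ 5 * α := by
  induction k with
  | zero =>
    simp only [Nat.cast_zero, zero_mul, brownian_zero, Pi.zero_apply, hf0, sub_zero, abs_zero]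
    refine ⟨hα, fun s hs => ?_⟩
    rw [nonpos_iff_eq_zero] at hs
    rw [hs, hf0]
    simp only [brownian_zero, Pi.zero_apply, sub_zero, abs_zero]
    positivity
  | succ k ih =>
    rw [setOf_forall_lt_succ] at hω
    have hcast : ((k + 1 : ℕ) : ℝ≥0) * τ = (k : ℝ≥0) * τ + τ := by push_cast; ring
    have hfmod' : ∀ s u : ℝ≥0, s ≤ u → u ≤ (k : ℝ≥0) * τ → u ≤ s + τ → |f u - f s| ≤ α / 8 :=
      fun s u hsu hu hus => hfmod s u hsu (hu.trans (by rw [hcast]; exact le_self_add)) hus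
    obtain ⟨hanchor, hpath⟩ := ih hfmod' hω.1
    obtain ⟨hdyad, hsign⟩ := (mem_tubeBlockGood_iff hE hB k ω).1 hω.2
    -- inside the block the path moves by at most `3α`
    have hmove : ∀ u : ℝ≥0, u ≤ τ →
        |brownian ((k : ℝ≥0) * τ + u) ω - brownian ((k : ℝ≥0) * τ) ω| ≤ 3 * α := fun u hu =>
      abs_le_of_dyadic (w := fun u => brownian ((k : ℝ≥0) * τ + u) ω - brownian ((k : ℝ≥0) * τ) ω)
        (((continuous_brownian ω).comp (continuous_const.add continuous_id)).sub continuous_const)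
        hdyad hu
    -- and the centre by at most `α/8`
    have hfmove : ∀ u : ℝ≥0, u ≤ τ → |f ((k : ℝ≥0) * τ + u) - f ((k : ℝ≥0) * τ)| ≤ α / 8 :=
      fun u hu => hfmod _ _ le_self_add (by rw [hcast]; gcongr) (by gcongr)
    -- the new anchor
    have hanchor' : |brownian ((k : ℝ≥0) * τ + τ) ω - f ((k : ℝ≥0) * τ + τ)| ≤ α := by
      have hft := hfmove τ le_rfl
      rw [abs_le] at hanchor hft ⊢
      by_cases h0 : f ((k : ℝ≥0) * τ) ≤ brownian ((k : ℝ≥0) * τ) ω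
      · simp only [h0, decide_true, ↓reduceIte, mem_Icc] at hsign
        constructor <;> linarith [hsign.1, hsign.2, hft.1, hft.2]
      · simp only [h0, decide_false, Bool.false_eq_true, ↓reduceIte, mem_Icc] at hsign
        push Not at h0
        constructor <;> linarith [hsign.1, hsign.2, hft.1, hft.2]
    refine ⟨by rw [hcast]; exact hanchor', fun s hs => ?_⟩
    rw [hcast] at hs
    rcases le_or_gt s ((k : ℝ≥0) * τ) with hsk | hsk
    · exact hpath s hsk
    · -- `s = kτ + u` with `u ≤ τ`
      set u : ℝ≥0 := s - (k : ℝ≥0) * τ with hu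
      have hsu : s = (k : ℝ≥0) * τ + u := by rw [hu, add_tsub_cancel_of_le hsk.le]
      have huτ : u ≤ τ := by
        rw [hu]
        exact tsub_le_iff_left.2 hs
      rw [hsu]
      have h1 := hmove u huτ
      have h2 := hfmove u huτ
      have h3 : brownian ((k : ℝ≥0) * τ + u) ω - f ((k : ℝ≥0) * τ + u) =
          (brownian ((k : ℝ≥0) * τ + u) ω - brownian ((k : ℝ≥0) * τ) ω) +
            (brownian ((k : ℝ≥0) * τ) ω - f ((k : ℝ≥0) * τ)) -
              (f ((k : ℝ≥0) * τ + u) - f ((k : ℝ≥0) * τ)) := by ring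
      rw [h3]
      calc |brownian ((k : ℝ≥0) * τ + u) ω - brownian ((k : ℝ≥0) * τ) ω +
              (brownian ((k : ℝ≥0) * τ) ω - f ((k : ℝ≥0) * τ)) -
              (f ((k : ℝ≥0) * τ + u) - f ((k : ℝ≥0) * τ))|
          ≤ |brownian ((k : ℝ≥0) * τ + u) ω - brownian ((k : ℝ≥0) * τ) ω +
              (brownian ((k : ℝ≥0) * τ) ω - f ((k : ℝ≥0) * τ))| +
              |f ((k : ℝ≥0) * τ + u) - f ((k : ℝ≥0) * τ)| := abs_sub _ _
        _ ≤ (|brownian ((k : ℝ≥0) * τ + u) ω - brownian ((k : ℝ≥0) * τ) ω| +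
              |brownian ((k : ℝ≥0) * τ) ω - f ((k : ℝ≥0) * τ)|) +
              |f ((k : ℝ≥0) * τ + u) - f ((k : ℝ≥0) * τ)| := by
            gcongr
            exact abs_add_le _ _
        _ ≤ (3 * α + α) + α / 8 := add_le_add (add_le_add h1 hanchor) h2
        _ ≤ 5 * α := by linarith

/-! ### The Markov step and the geometric bound -/

include hE hB in
/-- **The Markov step**: `P(first k+1 blocks good) ≥ min_b P(B ∈ E b) · P(first k blocks good)`
(`measure_inter_shift_preimage_ge` with the past-measurable bit `[B_{kτ} ≥ f(kτ)]`). [folklore] -/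
private theorem measure_tubeGoodUpTo_succ_ge (k : ℕ) :
    min (preWienerMeasure ((fun (ω : ℝ≥0 → ℝ) (u : ℝ≥0) => brownian u ω) ⁻¹' E true))
        (preWienerMeasure ((fun (ω : ℝ≥0 → ℝ) (u : ℝ≥0) => brownian u ω) ⁻¹' E false)) *
      preWienerMeasure {ω | ∀ j < k, ω ∈ B j} ≤ preWienerMeasure {ω | ∀ j < k + 1, ω ∈ B j} := by
  have hσ : Measurable[MeasurableSpace.comap (fun (ω : ℝ≥0 → ℝ) (v : Iic ((k : ℝ≥0) * τ)) =>
      brownian v ω) inferInstance]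
      (fun ω => decide (f ((k : ℝ≥0) * τ) ≤ brownian ((k : ℝ≥0) * τ) ω)) := by
    refine measurable_to_bool ?_
    have : (fun ω => decide (f ((k : ℝ≥0) * τ) ≤ brownian ((k : ℝ≥0) * τ) ω)) ⁻¹' {true} =
        {ω | f ((k : ℝ≥0) * τ) ≤ brownian ((k : ℝ≥0) * τ) ω} := by
      ext ω; simp
    rw [this]
    exact measurableSet_le measurable_const (measurable_brownian_comap_past le_rfl)
  have h := measure_inter_shift_preimage_ge ((k : ℝ≥0) * τ) (measurableSet_tubeGoodUpTo_comap hE hB k)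
    hσ E (measurableSet_of_eq_tubeBlockEvent hE)
  rw [setOf_forall_lt_succ, hB k]
  exact h

include hE hB in
/-- **`P(first k blocks good) ≥ p₀ᵏ`**, `p₀ = min_b P(B ∈ E b)`. [folklore] -/
private theorem pow_le_measure_tubeGoodUpTo (k : ℕ) :
    min (preWienerMeasure ((fun (ω : ℝ≥0 → ℝ) (u : ℝ≥0) => brownian u ω) ⁻¹' E true))
        (preWienerMeasure ((fun (ω : ℝ≥0 → ℝ) (u : ℝ≥0) => brownian u ω) ⁻¹' E false)) ^ k ≤
      preWienerMeasure {ω | ∀ j < k, ω ∈ B j} := by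
  haveI := RandomPlanarGeometry.isProbabilityMeasure_preWienerMeasure'
  exact pow_le_measure_setOf_forall_lt preWienerMeasure B _ (measure_tubeGoodUpTo_succ_ge hE hB) k

end Blocks

/-! ### One block is good with probability at least `1/24 − 2/289` -/

/-- **A block of length `τ ∈ [α²/4, α²/2]` is good with positive probability**:
`P(B ∈ E b) ≥ P(±B_τ ∈ [−7α/8, −α/8]) − P(∃ s ≤ τ, |B_s| ≥ 3α) ≥ 1/24 − 2/289 > 0`
(`gaussianReal_Icc_neg_ge` and the running-maximum bound `measure_exists_le_abs_brownian_le`).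
[folklore] -/
theorem tubeBlockProb_pos {τ : ℝ≥0} {α : ℝ} (hα : 0 < α) (hτ1 : α ^ 2 / 4 ≤ (τ : ℝ))
    (hτ2 : (τ : ℝ) ≤ α ^ 2 / 2) (b : Bool) :
    0 < preWienerMeasure ((fun (ω : ℝ≥0 → ℝ) (u : ℝ≥0) => brownian u ω) ⁻¹'
      {w : ℝ≥0 → ℝ | (∀ n m : ℕ, ((m : ℝ≥0) / 2 ^ n ≤ τ) → |w ((m : ℝ≥0) / 2 ^ n)| ≤ 3 * α) ∧
        (if b then w τ ∈ Icc (-(7 * α / 8)) (-(α / 8)) else w τ ∈ Icc (α / 8) (7 * α / 8))}) := by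
  haveI := RandomPlanarGeometry.isProbabilityMeasure_preWienerMeasure'
  -- the endpoint event `A` and the bad event
  set A : Set (ℝ≥0 → ℝ) := {ω | if b then brownian τ ω ∈ Icc (-(7 * α / 8)) (-(α / 8))
    else brownian τ ω ∈ Icc (α / 8) (7 * α / 8)} with hA
  set Bad : Set (ℝ≥0 → ℝ) := {ω | ∃ s ≤ τ, 3 * α ≤ |brownian s ω|} with hBad
  have hsub : A \ Bad ⊆ (fun (ω : ℝ≥0 → ℝ) (u : ℝ≥0) => brownian u ω) ⁻¹'
      {w : ℝ≥0 → ℝ | (∀ n m : ℕ, ((m : ℝ≥0) / 2 ^ n ≤ τ) → |w ((m : ℝ≥0) / 2 ^ n)| ≤ 3 * α) ∧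
        (if b then w τ ∈ Icc (-(7 * α / 8)) (-(α / 8)) else w τ ∈ Icc (α / 8) (7 * α / 8))} := by
    rintro ω ⟨hωA, hωB⟩
    refine ⟨fun n m hmn => ?_, ?_⟩
    · by_contra hlt
      push Not at hlt
      exact hωB ⟨_, hmn, hlt.le⟩
    · simpa [hA] using hωA
  -- `P(A) ≥ 1/24`
  have hPA : ENNReal.ofReal (1 / 24) ≤ preWienerMeasure A := by
    have hlaw := (RandomPlanarGeometry.isPreBrownianReal_brownian.hasLaw_eval τ).map_eq
    have hAeq : A = brownian τ ⁻¹' (if b then Icc (-(7 * α / 8)) (-(α / 8)) else Icc (α / 8) (7 * α / 8)) := by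
      ext ω; cases b <;> simp [hA]
    have hmeas : MeasurableSet
        (if b then Icc (-(7 * α / 8)) (-(α / 8)) else Icc (α / 8) (7 * α / 8) : Set ℝ) := by
      cases b <;> exact measurableSet_Icc
    rw [hAeq, ← Measure.map_apply (measurable_brownian τ) hmeas, hlaw]
    cases b
    · exact gaussianReal_Icc_pos_ge hα hτ1 hτ2
    · exact gaussianReal_Icc_neg_ge hα hτ1 hτ2
  -- `P(Bad) ≤ 2/289`
  have hPBad : preWienerMeasure Bad ≤ ENNReal.ofReal (2 / 289) := by
    have hτ4 : (τ : ℝ) < (3 * α) ^ 2 := by nlinarith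
    refine (measure_exists_le_abs_brownian_le τ (by positivity : (0 : ℝ) ≤ 3 * α) hτ4).trans
      (ENNReal.ofReal_le_ofReal ?_)
    have hden : 17 * α ^ 2 / 2 ≤ (3 * α) ^ 2 - τ := by nlinarith
    have hden0 : 0 < 17 * α ^ 2 / 2 := by positivity
    have hτ0 : (0 : ℝ) ≤ τ := τ.coe_nonneg
    rw [div_le_iff₀ (by positivity)]
    have h1 : (τ : ℝ) ^ 2 ≤ (α ^ 2 / 2) ^ 2 := pow_le_pow_left₀ hτ0 hτ2 2
    have h2 : (17 * α ^ 2 / 2) ^ 2 ≤ ((3 * α) ^ 2 - τ) ^ 2 := pow_le_pow_left₀ hden0.le hden 2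
    nlinarith
  -- conclude
  have hlt : preWienerMeasure Bad < preWienerMeasure A :=
    lt_of_le_of_lt hPBad (lt_of_lt_of_le ((ENNReal.ofReal_lt_ofReal_iff (by norm_num)).2
      (by norm_num)) hPA)
  calc (0 : ℝ≥0∞) < preWienerMeasure A - preWienerMeasure Bad := tsub_pos_of_lt hlt
    _ ≤ preWienerMeasure (A \ Bad) := by
        refine tsub_le_iff_right.2 ?_
        calc preWienerMeasure A ≤ preWienerMeasure ((A \ Bad) ∪ Bad) :=
              measure_mono (fun ω hω => by
                by_cases h : ω ∈ Bad
                · exact Or.inr h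
                · exact Or.inl ⟨hω, h⟩)
          _ ≤ preWienerMeasure (A \ Bad) + preWienerMeasure Bad := measure_union_le _ _
    _ ≤ _ := measure_mono hsub

/-! ### The tube theorem -/

/-- **The tube theorem under the normalisation `L ε ≤ 1`**: for `f` with `f 0 = 0` and
`|f u − f s| ≤ L (u − s)` for `s ≤ u ≤ t`, and `0 < ε` with `L ε ≤ 1`,
`P(∀ s ≤ t, |B_s − f s| ≤ ε) > 0`. [folklore] -/
theorem measure_forall_abs_brownian_sub_le_pos_of_mul_le (t : ℝ≥0) {ε L : ℝ} (hε : 0 < ε)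
    (hL : 0 ≤ L) (hLε : L * ε ≤ 1) {f : ℝ≥0 → ℝ} (hf0 : f 0 = 0)
    (hf : ∀ s u : ℝ≥0, s ≤ u → u ≤ t → |f u - f s| ≤ L * ((u : ℝ) - s)) :
    0 < preWienerMeasure {ω | ∀ s : ℝ≥0, s ≤ t → |brownian s ω - f s| ≤ ε} := by
  set α : ℝ := ε / 5 with hαdef
  have hα : 0 < α := by positivity
  -- `|f s| ≤ L s` on `[0, t]`
  have hfs : ∀ s : ℝ≥0, s ≤ t → |f s| ≤ L * s := fun s hs ↦ by
    have := hf 0 s bot_le hs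
    rwa [hf0, sub_zero, NNReal.coe_zero, sub_zero] at this
  by_cases hsmall : (t : ℝ) < α ^ 2 / 2
  · -- very short horizon: the zero-centre small ball of radius `ε/2` suffices
    have hsub : {ω | ∀ s : ℝ≥0, s ≤ t → |brownian s ω| ≤ ε / 2} ⊆
        {ω | ∀ s : ℝ≥0, s ≤ t → |brownian s ω - f s| ≤ ε} := by
      intro ω hω s hs
      have h1 := hω s hs
      have h2 : |f s| ≤ ε / 2 := by
        refine (hfs s hs).trans ?_
        have hst : (s : ℝ) ≤ t := by exact_mod_cast hs
        calc L * s ≤ L * (α ^ 2 / 2) := by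
              gcongr
              exact hst.trans hsmall.le
          _ = (L * ε) * ε / 50 := by rw [hαdef]; ring
          _ ≤ 1 * ε / 50 := by gcongr
          _ ≤ ε / 2 := by linarith
      calc |brownian s ω - f s| ≤ |brownian s ω| + |f s| := abs_sub _ _
        _ ≤ ε / 2 + ε / 2 := add_le_add h1 h2
        _ = ε := by ring
    exact lt_of_lt_of_le (measure_forall_abs_brownian_le_pos t (half_pos hε)) (measure_mono hsub)
  · -- the number of blocks `n = ⌈2t/α²⌉` and the block length `τ = t/n ∈ [α²/4, α²/2]`
    push Not at hsmall
    set x : ℝ := 2 * t / α ^ 2 with hxdef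
    have hx1 : 1 ≤ x := by
      rw [hxdef, le_div_iff₀ (by positivity)]
      linarith
    set n : ℕ := ⌈x⌉₊ with hndef
    have hn1 : (1 : ℝ) ≤ n := by
      rw [hndef]
      exact_mod_cast Nat.one_le_cast.2 (Nat.lt_ceil.2 (by exact_mod_cast lt_of_lt_of_le zero_lt_one hx1))
    have hn0 : 0 < n := by exact_mod_cast (lt_of_lt_of_le zero_lt_one hn1 : (0 : ℝ) < n)
    have hnx : x ≤ n := Nat.le_ceil x
    have hn2x : (n : ℝ) ≤ 2 * x := by
      have := Nat.ceil_lt_add_one (le_trans zero_le_one hx1)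
      rw [hndef]
      linarith
    set τ : ℝ≥0 := t / n with hτ
    have hnt : (n : ℝ≥0) * τ = t := by
      rw [hτ, mul_div_cancel₀ _ (by exact_mod_cast hn0.ne')]
    have hτreal : (τ : ℝ) = t / n := by rw [hτ, NNReal.coe_div, NNReal.coe_natCast]
    have hτ2 : (τ : ℝ) ≤ α ^ 2 / 2 := by
      rw [hτreal, div_le_iff₀ (by positivity)]
      have : (t : ℝ) = x * (α ^ 2 / 2) := by rw [hxdef]; field_simp
      rw [this]
      calc x * (α ^ 2 / 2) ≤ n * (α ^ 2 / 2) := by gcongr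
        _ = α ^ 2 / 2 * n := by ring
    have hτ1 : α ^ 2 / 4 ≤ (τ : ℝ) := by
      rw [hτreal, le_div_iff₀ (by positivity)]
      have : (t : ℝ) = x * (α ^ 2 / 2) := by rw [hxdef]; field_simp
      rw [this]
      nlinarith [hn2x, hα]
    -- `f` moves by at most `α/8` over a time span `≤ τ` inside `[0, t]`
    have hfmod : ∀ s u : ℝ≥0, s ≤ u → u ≤ (n : ℝ≥0) * τ → u ≤ s + τ → |f u - f s| ≤ α / 8 := by
      intro s u hsu hu hus
      rw [hnt] at hu
      refine (hf s u hsu hu).trans ?_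
      have h1 : (u : ℝ) - s ≤ τ := by
        have : (u : ℝ) ≤ s + τ := by exact_mod_cast hus
        linarith
      calc L * ((u : ℝ) - s) ≤ L * τ := by gcongr
        _ ≤ L * (α ^ 2 / 2) := by gcongr
        _ = (L * ε) * α / 10 := by rw [hαdef]; ring
        _ ≤ 1 * α / 10 := by gcongr
        _ ≤ α / 8 := by linarith
    -- the block events
    set E : Bool → Set (ℝ≥0 → ℝ) := fun b => {w : ℝ≥0 → ℝ | (∀ n m : ℕ, ((m : ℝ≥0) / 2 ^ n ≤ τ) →
        |w ((m : ℝ≥0) / 2 ^ n)| ≤ 3 * α) ∧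
          (if b then w τ ∈ Icc (-(7 * α / 8)) (-(α / 8)) else w τ ∈ Icc (α / 8) (7 * α / 8))}
      with hEdef
    have hE : ∀ b, E b = {w : ℝ≥0 → ℝ | (∀ n m : ℕ, ((m : ℝ≥0) / 2 ^ n ≤ τ) →
        |w ((m : ℝ≥0) / 2 ^ n)| ≤ 3 * α) ∧
          (if b then w τ ∈ Icc (-(7 * α / 8)) (-(α / 8)) else w τ ∈ Icc (α / 8) (7 * α / 8))} :=
      fun b => rfl
    set B : ℕ → Set (ℝ≥0 → ℝ) := fun k => {ω | (fun u => brownian ((k : ℝ≥0) * τ + u) ω -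
        brownian ((k : ℝ≥0) * τ) ω) ∈ E (decide (f ((k : ℝ≥0) * τ) ≤ brownian ((k : ℝ≥0) * τ) ω))}
      with hBdef
    have hB : ∀ k : ℕ, B k = {ω | (fun u => brownian ((k : ℝ≥0) * τ + u) ω -
        brownian ((k : ℝ≥0) * τ) ω) ∈ E (decide (f ((k : ℝ≥0) * τ) ≤ brownian ((k : ℝ≥0) * τ) ω))} :=
      fun k => rfl
    -- `{first n blocks good} ⊆ {∀ s ≤ t, |B_s − f s| ≤ ε}`
    have hsub : {ω | ∀ j < n, ω ∈ B j} ⊆ {ω | ∀ s : ℝ≥0, s ≤ t → |brownian s ω - f s| ≤ ε} := by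
      intro ω hω s hs
      have h := (abs_brownian_sub_le_of_mem_tubeGoodUpTo hE hB hα.le hf0 hfmod hω).2 s
      rw [hnt] at h
      exact (h hs).trans (by rw [hαdef]; linarith)
    refine lt_of_lt_of_le ?_ (measure_mono hsub)
    refine lt_of_lt_of_le ?_ (pow_le_measure_tubeGoodUpTo hE hB n)
    refine ENNReal.pow_pos (lt_min ?_ ?_) n
    · rw [hE]; exact tubeBlockProb_pos hα hτ1 hτ2 true
    · rw [hE]; exact tubeBlockProb_pos hα hτ1 hτ2 false

/-- **Tubes around Lipschitz paths have positive Wiener measure** (the support theorem for Wiener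
measure, lower bound, Lipschitz centres): for every `t ≥ 0`, `ε > 0` and every `f : ℝ≥0 → ℝ` with
`f 0 = 0` and `|f u − f s| ≤ L (u − s)` for `s ≤ u ≤ t`, `P(∀ s ≤ t, |B_s − f s| ≤ ε) > 0` for the
canonical Brownian motion under the pre-Wiener measure. Freedman (1971), §1.6; Stroock–Varadhan
(1972), §3. (Shrink `ε` to `ε' = min(ε, 1/(L+1))`, so that `L ε' ≤ 1`, and apply
`measure_forall_abs_brownian_sub_le_pos_of_mul_le`.) [folklore] -/
theorem measure_forall_abs_brownian_sub_le_pos (t : ℝ≥0) {ε L : ℝ} (hε : 0 < ε) (hL : 0 ≤ L)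
    {f : ℝ≥0 → ℝ} (hf0 : f 0 = 0)
    (hf : ∀ s u : ℝ≥0, s ≤ u → u ≤ t → |f u - f s| ≤ L * ((u : ℝ) - s)) :
    0 < preWienerMeasure {ω | ∀ s : ℝ≥0, s ≤ t → |brownian s ω - f s| ≤ ε} := by
  set ε' : ℝ := min ε (1 / (L + 1)) with hε'
  have hε'pos : 0 < ε' := lt_min hε (by positivity)
  have hε'le : ε' ≤ ε := min_le_left _ _
  have hLε' : L * ε' ≤ 1 := by
    calc L * ε' ≤ L * (1 / (L + 1)) := by gcongr; exact min_le_right _ _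
      _ = L / (L + 1) := by ring
      _ ≤ 1 := by rw [div_le_one (by positivity)]; linarith
  refine lt_of_lt_of_le (measure_forall_abs_brownian_sub_le_pos_of_mul_le t hε'pos hL hLε' hf0 hf)
    (measure_mono fun ω hω s hs ↦ (hω s hs).trans hε'le)

/-- **The same for a globally Lipschitz centre** (`LipschitzWith`), the form most often at hand.
[folklore] -/
theorem measure_forall_abs_brownian_sub_le_pos_of_lipschitzWith (t : ℝ≥0) {ε : ℝ} (hε : 0 < ε)
    {K : ℝ≥0} {f : ℝ≥0 → ℝ} (hf : LipschitzWith K f) (hf0 : f 0 = 0) :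
    0 < preWienerMeasure {ω | ∀ s : ℝ≥0, s ≤ t → |brownian s ω - f s| ≤ ε} := by
  refine measure_forall_abs_brownian_sub_le_pos t hε K.coe_nonneg hf0 fun s u hsu _ ↦ ?_
  have h := hf.dist_le_mul u s
  rw [Real.dist_eq, NNReal.dist_eq] at h
  have hus : (0 : ℝ) ≤ (u : ℝ) - (s : ℝ) := sub_nonneg.2 (by exact_mod_cast hsu)
  rwa [abs_of_nonneg hus] at h

/-- **Tubes for the pair of independent Brownian motions**: for Lipschitz centres `f₁`, `f₂` with
`fᵢ 0 = 0`, `P(∀ s ≤ t, |B¹_s − f₁ s| ≤ ε ∧ |B²_s − f₂ s| ≤ ε) > 0` under `wienerPair` (product of the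
two one-dimensional tube probabilities). [folklore] -/
theorem wienerPair_forall_abs_brownian_sub_le_pos (t : ℝ≥0) {ε L : ℝ} (hε : 0 < ε) (hL : 0 ≤ L)
    {f₁ f₂ : ℝ≥0 → ℝ} (hf₁0 : f₁ 0 = 0) (hf₂0 : f₂ 0 = 0)
    (hf₁ : ∀ s u : ℝ≥0, s ≤ u → u ≤ t → |f₁ u - f₁ s| ≤ L * ((u : ℝ) - s))
    (hf₂ : ∀ s u : ℝ≥0, s ≤ u → u ≤ t → |f₂ u - f₂ s| ≤ L * ((u : ℝ) - s)) :
    0 < wienerPair {ω : WienerPair | ∀ s : ℝ≥0, s ≤ t →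
      |brownian s ω.1 - f₁ s| ≤ ε ∧ |brownian s ω.2 - f₂ s| ≤ ε} := by
  haveI := RandomPlanarGeometry.isProbabilityMeasure_preWienerMeasure'
  set A₁ : Set (ℝ≥0 → ℝ) := {ω | ∀ s : ℝ≥0, s ≤ t → |brownian s ω - f₁ s| ≤ ε} with hA₁
  set A₂ : Set (ℝ≥0 → ℝ) := {ω | ∀ s : ℝ≥0, s ≤ t → |brownian s ω - f₂ s| ≤ ε} with hA₂
  have hprod : {ω : WienerPair | ∀ s : ℝ≥0, s ≤ t →
      |brownian s ω.1 - f₁ s| ≤ ε ∧ |brownian s ω.2 - f₂ s| ≤ ε} = A₁ ×ˢ A₂ := by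
    ext ω
    simp only [mem_setOf_eq, mem_prod, hA₁, hA₂]
    constructor
    · intro h
      exact ⟨fun s hs => (h s hs).1, fun s hs => (h s hs).2⟩
    · rintro ⟨h1, h2⟩ s hs
      exact ⟨h1 s hs, h2 s hs⟩
  rw [hprod, wienerPair, Measure.prod_prod]
  exact ENNReal.mul_pos (measure_forall_abs_brownian_sub_le_pos t hε hL hf₁0 hf₁).ne'
    (measure_forall_abs_brownian_sub_le_pos t hε hL hf₂0 hf₂).ne'

end Literature.Probability.Process
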